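import Literature.AlgebraicGeometry.Resolution.AffineBlowupAlgebra
import Mathlib.RingTheory.IntegralClosure.IntegrallyClosed
import Mathlib.RingTheory.Polynomial.ScaleRoots
import Mathlib.RingTheory.Localization.LocalizationLocalization
import Mathlib.AlgebraicGeometry.AffineScheme
import HarnessLib

/-!
# Crux `NoZenoR` (stmt-ResolutionOfSingularities-19943) — Lipman 1969, Lemma (5.2), affine normal case:
# if all powers `Iⁿ` of an ideal of a normal domain are integrally closed, the blowing up `Bl_I(Spec R)` is normal

Route `ResolutionOfSingularities/HomologicalConductor` (cell decomp-res, hand leafhand-res-homologicalconduct-22 g0).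
OURS: AI-written, weaker than expert review; nothing here is a statement of the manuscript under review (Hironaka 2017).
SUPPORT level, counted 0.  Def-free, fact-free.

This is the first input (E1) of the discharge of the NAMED FACT `Lipman1969_8_1` (Lipman 1969, Prop. (8.1):
quadratic transforms of rational surface singularities are normal; `Literature/…/Lipman1969QuadraticTransformNormal`),
whose printed proof reads «The first assertion follows from Theorem (7.1) and Lemma (5.2)» (p. 212):

* Lemma (5.2) (p. 206): «Let `X` be an integral scheme and let `𝒥 ≠ 0` be a quasi-coherent `𝒪_X`-submodule of `𝒦`.
  If all the positive powers of `𝒥` are complete, then the scheme obtained by blowing up `𝒥` is normal.»  For `X` normal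
  the completion of an ideal is its integral closure (p. 206: «when `X` is normal, `⊕ 𝒦ⁿ` is integrally closed, so that
  if `𝒥` is an `𝒪_X`-ideal then so is `𝒥̄ₙ` for each `n`»), i.e. «complete» = «integrally closed» in the sense of
  Huneke–Swanson Def. 1.1.1 (the tree's `Literature/RingTheory/IntegralClosure/*`, equations of integral dependence
  `r^k + ∑_{j=1}^{k} c_j r^{k-j} = 0`, `c_j ∈ (Iⁿ)^j`).

PROVED here, for an integrally closed domain `R`, an ideal `I ⊆ R` all of whose powers are integrally closed, and
`a ∈ I`, `a ≠ 0`: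

* `exists_eq_mul_invSelf_pow_of_mem_blowupAlgebra` — every element of the affine blowup algebra `R[I/a] ⊆ R[1/a]`
  (`blowupAlgebra I a`, `AffineBlowupAlgebra.lean`; Stacks 052Q) is a fraction `c/aⁿ` with `c ∈ Iⁿ`;
* `isIntegrallyClosed_blowupAlgebra` — **`R[I/a]` is an integrally closed domain**: if `x ∈ Frac R` is a root of a
  monic polynomial over `R[I/a]` with coefficients `c_i/a^{N}`-shaped, then `y = a^N x` is a root of a monic polynomial
  over `R` whose `i`-th coefficient lies in `(I^N)^{m-i}` (`Polynomial.scaleRoots`), so `y ∈ R` (normality) and then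
  `y ∈ \overline{I^N} = I^N`, i.e. `x = y/a^N ∈ R[I/a]`;
* `affineBlowup.isIntegrallyClosed_stalk_of_forall_pow` — **Lemma (5.2)**: every local ring of
  `Bl_I(Spec R) = Proj R[It]` (`affineBlowup I`) is an integrally closed domain (the charts `D₊(at) = Spec R[I/a]`,
  `a ∈ I ∖ 0`, cover it — `affineBlowup.iSup_basicOpen_reesT_eq_top`, `reesChartEquiv` — and local rings are
  localizations of the chart rings, Mathlib `IsAffineOpen.isLocalization_stalk`, `isIntegrallyClosed_of_isLocalization`).

No crux, kill test or summit statement is proved here; resolution in positive characteristic is NOT proved.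

References: J. Lipman, *Rational singularities, with applications to algebraic surfaces and unique factorization*, Publ.
Math. IHÉS 36 (1969), §5, Lemma (5.2) (p. 206), Proposition (8.1) (p. 212) [`Lipman1969`]; C. Huneke, I. Swanson,
*Integral Closure of Ideals, Rings, and Modules* (2006), Def. 1.1.1, Prop. 5.2.4 [`HunekeSwanson2006`]; The Stacks
Project, Tag 052Q, Tag 0804 [`StacksProject`].
-/

noncomputable section

-- single-problem summit: the doubled namespace component `ResolutionOfSingularities` is forced
set_option linter.dupNamespace false

open CategoryTheory AlgebraicGeometry TopologicalSpace Polynomial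
open Literature.AlgebraicGeometry.Resolution

namespace Summit.ResolutionOfSingularities.ResolutionOfSingularities.Theorems.NoZeno.QuadraticTransform

universe u

section Algebra

variable {R : Type u} [CommRing R] {I : Ideal R} {a : R}

/-- **The elements of `R[I/a]` are the fractions `c/aⁿ`, `c ∈ Iⁿ`** (Stacks 052Q: every element of the affine blowup
algebra is "represented by an expression of the form `x/aⁿ` with `x ∈ Iⁿ`"; here read off the chart isomorphism
`(R[It])_{(at)} ≅ R[I/a]` of `AffineBlowupAlgebra.lean`). [cite: StacksProject, Tag 052Q] -/
theorem exists_eq_mul_invSelf_pow_of_mem_blowupAlgebra (ha : a ∈ I) {z : Localization.Away a}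
    (hz : z ∈ blowupAlgebra I a) :
    ∃ (n : ℕ) (c : R), c ∈ I ^ n ∧
      z = algebraMap R (Localization.Away a) c * IsLocalization.Away.invSelf a ^ n := by
  have hz' : z ∈ Set.range (reesChart a ha) := by
    rw [range_reesChart a ha]
    exact hz
  obtain ⟨y, rfl⟩ := hz'
  obtain ⟨n, x, hx, rfl⟩ :=
    HomogeneousLocalization.Away.mk_surjective (reesGrading I) (reesT_mem a ha) y
  obtain ⟨r, hr⟩ := (mem_reesGrading_iff I).mp hx
  have hn : (n • 1 : ℕ) = n := by simp
  have hr' : (x : R[X]) = monomial n r := by rw [← hr, hn]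
  have hrI : r ∈ I ^ n := by
    have := x.2
    rw [hr', reesAlgebra.monomial_mem] at this
    exact this
  exact ⟨n, r, hrI, reesChart_mk a ha hx hr'⟩

/-- `(1/a)ⁿ · a^M = a^{M-n}` in `R[1/a]` for `n ≤ M`. [folklore] -/
theorem invSelf_pow_mul_algebraMap_pow (a : R) {n M : ℕ} (h : n ≤ M) :
    IsLocalization.Away.invSelf a ^ n * algebraMap R (Localization.Away a) a ^ M =
      algebraMap R (Localization.Away a) a ^ (M - n) := by
  have h1 : algebraMap R (Localization.Away a) a * IsLocalization.Away.invSelf a = 1 :=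
    IsLocalization.Away.mul_invSelf a
  calc IsLocalization.Away.invSelf a ^ n * algebraMap R (Localization.Away a) a ^ M
      = IsLocalization.Away.invSelf a ^ n * algebraMap R (Localization.Away a) a ^ (n + (M - n)) := by
        rw [Nat.add_sub_cancel' h]
    _ = (algebraMap R (Localization.Away a) a * IsLocalization.Away.invSelf a) ^ n *
          algebraMap R (Localization.Away a) a ^ (M - n) := by
        rw [pow_add, mul_pow]; ring
    _ = algebraMap R (Localization.Away a) a ^ (M - n) := by rw [h1, one_pow, one_mul]

/-- An equation `q(r) = 0` with `q ∈ R[X]` monic of degree `m` and `q_i ∈ J^{m-i}` for `i < m` is an equation of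
integral dependence of `r` over the ideal `J` in the sense of Huneke–Swanson, Def. 1.1.1 (the tree's format,
`Literature/RingTheory/IntegralClosure/IntegralOverIdealRees`). [cite: HunekeSwanson2006, Def. 1.1.1] -/
theorem exists_integralDependence_of_eval_eq_zero {J : Ideal R} {q : R[X]} (hq : q.Monic)
    (hcoeff : ∀ i < q.natDegree, q.coeff i ∈ J ^ (q.natDegree - i)) {r : R} (hr : q.eval r = 0) :
    ∃ (k : ℕ) (c : ℕ → R), (∀ j ∈ Finset.Icc 1 k, c j ∈ J ^ j) ∧
      r ^ k + ∑ j ∈ Finset.Icc 1 k, c j * r ^ (k - j) = 0 := by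
  set m := q.natDegree with hm
  refine ⟨m, fun j => q.coeff (m - j), fun j hj => ?_, ?_⟩
  · have hj' := Finset.mem_Icc.1 hj
    have h := hcoeff (m - j) (by omega)
    rwa [Nat.sub_sub_self hj'.2] at h
  · rw [eval_eq_sum_range, Finset.sum_range_succ, hq.coeff_natDegree, one_mul, add_comm] at hr
    rw [← hr]
    congr 1
    refine Finset.sum_nbij' (fun j => m - j) (fun i => m - i) ?_ ?_ ?_ ?_ ?_
    · intro j hj
      simp only [Finset.mem_Icc] at hj
      simp only [Finset.mem_range]
      omega
    · intro i hi
      simp only [Finset.mem_range] at hi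
      simp only [Finset.mem_Icc]
      omega
    · intro j hj
      simp only [Finset.mem_Icc] at hj
      omega
    · intro i hi
      simp only [Finset.mem_range] at hi
      omega
    · intro j hj
      rfl

/-- **`R[I/a]` is integrally closed when `R` is normal and all powers `Iⁿ` are integrally closed** (Lipman 1969, proof
of Lemma (5.2) / Huneke–Swanson Prop. 5.2.4 on the chart `D₊(at)`): for `x ∈ Frac R` integral over `R[I/a]`, clearing
the denominators `a^N` of a monic equation (`Polynomial.scaleRoots`) makes `y = a^N x` integral over `R` with an equation
whose `i`-th coefficient lies in `(I^N)^{m-i}`; so `y ∈ R` and `y ∈ \overline{I^N} = I^N`, whence `x = y/a^N ∈ R[I/a]`.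
[cite: Lipman1969, Lemma (5.2) (p. 206)] -/
theorem isIntegrallyClosed_blowupAlgebra [IsDomain R] [IsIntegrallyClosed R] (ha : a ∈ I) (ha0 : a ≠ 0)
    (hI : ∀ (n : ℕ) (r : R), (∃ (k : ℕ) (c : ℕ → R), (∀ j ∈ Finset.Icc 1 k, c j ∈ (I ^ n) ^ j) ∧
      r ^ k + ∑ j ∈ Finset.Icc 1 k, c j * r ^ (k - j) = 0) → r ∈ I ^ n) :
    IsIntegrallyClosed (blowupAlgebra I a) := by
  classical
  let K := FractionRing R
  have hM : Submonoid.powers a ≤ nonZeroDivisors R := powers_le_nonZeroDivisors_of_noZeroDivisors ha0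
  haveI : IsDomain (Localization.Away a) := IsLocalization.isDomain_localization hM
  -- `R → R[1/a]` and `R → R[I/a]` are injective
  have hinjRL : Function.Injective (algebraMap R (Localization.Away a)) :=
    IsLocalization.injective (Localization.Away a) hM
  have hRA : ∀ r : R, ((algebraMap R (blowupAlgebra I a) r : blowupAlgebra I a) : Localization.Away a) =
      algebraMap R (Localization.Away a) r := fun r => rfl
  have hinjRA : Function.Injective (algebraMap R (blowupAlgebra I a)) := fun r₁ r₂ h => by
    apply hinjRL
    rw [← hRA, ← hRA, h]
  -- the comparison map `R[1/a] → K = Frac R`; `R[I/a]` acts on `K` through it (`Subalgebra.toAlgebra`)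
  let g : Localization.Away a →+* K := IsLocalization.map K (T := nonZeroDivisors R) (RingHom.id R) hM
  letI : Algebra (Localization.Away a) K := g.toAlgebra
  haveI : IsScalarTower R (Localization.Away a) K := IsScalarTower.of_algebraMap_eq' (by
    rw [RingHom.algebraMap_toAlgebra, IsLocalization.map_comp, RingHomCompTriple.comp_eq])
  haveI : IsFractionRing (Localization.Away a) K :=
    IsFractionRing.isFractionRing_of_isDomain_of_isLocalization (Submonoid.powers a) (Localization.Away a) K
  have hinjLK : Function.Injective (algebraMap (Localization.Away a) K) :=
    IsFractionRing.injective (Localization.Away a) K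
  haveI : FaithfulSMul (Localization.Away a) K := (faithfulSMul_iff_algebraMap_injective _ K).mpr hinjLK
  have hAK : ∀ z : blowupAlgebra I a, algebraMap (blowupAlgebra I a) K z =
      algebraMap (Localization.Away a) K (z : Localization.Away a) := fun z => rfl
  have hinjAK : Function.Injective (algebraMap (blowupAlgebra I a) K) := fun z₁ z₂ h => by
    apply Subtype.ext
    apply hinjLK
    rw [← hAK, ← hAK, h]
  haveI : IsIntegrallyClosedIn (blowupAlgebra I a) K := by
    refine isIntegrallyClosedIn_iff.mpr ⟨hinjAK, fun {x} hx => ?_⟩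
    obtain ⟨p, hpmonic, hpx⟩ := hx
    set m := p.natDegree with hm
    -- the coefficients `p_i = c_i / a^{n_i}`, `c_i ∈ I^{n_i}`
    have hcoef : ∀ i : ℕ, ∃ (n : ℕ) (c : R), c ∈ I ^ n ∧
        ((p.coeff i : blowupAlgebra I a) : Localization.Away a) =
          algebraMap R (Localization.Away a) c * IsLocalization.Away.invSelf a ^ n :=
      fun i => exists_eq_mul_invSelf_pow_of_mem_blowupAlgebra ha (p.coeff i).2
    choose n c hcI hc using hcoef
    set N := (Finset.range (m + 1)).sup n with hN
    have hnN : ∀ i, i < m → n i ≤ N := fun i hi =>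
      Finset.le_sup (f := n) (Finset.mem_range.mpr (by omega))
    have hnN' : ∀ i, i < m → n i ≤ N * (m - i) := fun i hi => by
      have h1 := hnN i hi
      have h2 : N ≤ N * (m - i) := Nat.le_mul_of_pos_right N (by omega)
      omega
    -- clear denominators: `q = scaleRoots p (a^N)` has the root `y = a^N x`
    set s : blowupAlgebra I a := algebraMap R (blowupAlgebra I a) (a ^ N) with hs
    set q := scaleRoots p s with hq
    have hqmonic : q.Monic := (monic_scaleRoots_iff s).mpr hpmonic
    have hqdeg : q.natDegree = m := natDegree_scaleRoots p s
    have hpx' : aeval x p = 0 := by rw [aeval_def]; exact hpx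
    have hqx : aeval (algebraMap (blowupAlgebra I a) K s * x) q = 0 := scaleRoots_aeval_eq_zero hpx'
    -- the coefficients of `q` come from `R`: `q_i = d_i ∈ (I^N)^{m-i}` for `i < m`
    set d : ℕ → R := fun i => c i * a ^ (N * (m - i) - n i) with hd
    have hdI : ∀ i, i < m → d i ∈ (I ^ N) ^ (m - i) := by
      intro i hi
      rw [← pow_mul]
      have : I ^ (N * (m - i)) = I ^ (n i) * I ^ (N * (m - i) - n i) := by
        rw [← pow_add, Nat.add_sub_cancel' (hnN' i hi)]
      rw [this]
      exact Ideal.mul_mem_mul (hcI i) (Ideal.pow_mem_pow ha _)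
    have hqcoeff : ∀ i, i < m → q.coeff i = algebraMap R (blowupAlgebra I a) (d i) := by
      intro i hi
      rw [hq, coeff_scaleRoots, ← hm]
      apply Subtype.ext
      change ((p.coeff i : blowupAlgebra I a) : Localization.Away a) *
          ((s ^ (m - i) : blowupAlgebra I a) : Localization.Away a) = algebraMap R (Localization.Away a) (d i)
      have hsL : ((s ^ (m - i) : blowupAlgebra I a) : Localization.Away a) =
          algebraMap R (Localization.Away a) a ^ (N * (m - i)) := by
        rw [SubmonoidClass.coe_pow, hs, hRA, map_pow, ← pow_mul]
      rw [hc i, hsL, mul_assoc, invSelf_pow_mul_algebraMap_pow a (hnN' i hi), hd]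
      simp only [map_mul, map_pow]
    have hqlifts : q ∈ Polynomial.lifts (algebraMap R (blowupAlgebra I a)) := by
      rw [lifts_iff_coeff_lifts]
      intro i
      rcases Nat.lt_trichotomy i m with hi | hi | hi
      · exact ⟨d i, (hqcoeff i hi).symm⟩
      · refine ⟨1, ?_⟩
        rw [map_one, hi, ← hqdeg, hqmonic.coeff_natDegree]
      · refine ⟨0, ?_⟩
        rw [map_zero, coeff_eq_zero_of_natDegree_lt (by omega)]
    obtain ⟨q₀, hq₀, hq₀deg, hq₀monic⟩ := lifts_and_natDegree_eq_and_monic hqlifts hqmonic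
    -- `y = a^N x` is integral over `R`, hence in `R`
    set y : K := algebraMap (blowupAlgebra I a) K s * x with hy
    have hyq₀ : aeval y q₀ = 0 := by
      rw [← aeval_map_algebraMap (blowupAlgebra I a) y q₀, hq₀]
      exact hqx
    have hyint : IsIntegral R y := ⟨q₀, hq₀monic, by rw [← aeval_def]; exact hyq₀⟩
    obtain ⟨r, hr⟩ : ∃ r : R, algebraMap R K r = y := IsIntegrallyClosed.algebraMap_eq_of_integral hyint
    -- `r` satisfies an equation of integral dependence over `I^N`, so `r ∈ I^N`
    have hq₀eval : q₀.eval r = 0 := by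
      apply IsFractionRing.injective R K
      rw [map_zero, ← aeval_algebraMap_apply_eq_algebraMap_eval, hr]
      exact hyq₀
    have hq₀coeff : ∀ i < q₀.natDegree, q₀.coeff i ∈ (I ^ N) ^ (q₀.natDegree - i) := by
      intro i hi
      rw [hq₀deg, hqdeg] at hi ⊢
      have h1 : algebraMap R (blowupAlgebra I a) (q₀.coeff i) = algebraMap R (blowupAlgebra I a) (d i) := by
        rw [← hqcoeff i hi, ← hq₀, coeff_map]
      rw [hinjRA h1]
      exact hdI i hi
    have hrI : r ∈ I ^ N := hI N r (exists_integralDependence_of_eval_eq_zero hq₀monic hq₀coeff hq₀eval)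
    -- hence `x = r / a^N ∈ R[I/a]`
    refine ⟨⟨algebraMap R (Localization.Away a) r * IsLocalization.Away.invSelf a ^ N,
      algebraMap_mul_invSelf_pow_mem_blowupAlgebra a N hrI⟩, ?_⟩
    have hs0 : algebraMap (blowupAlgebra I a) K s ≠ 0 := by
      intro h0
      apply pow_ne_zero N ha0
      apply hinjRA
      rw [map_zero]
      exact hinjAK (by rw [map_zero]; exact h0)
    have hzs : (⟨algebraMap R (Localization.Away a) r * IsLocalization.Away.invSelf a ^ N,
        algebraMap_mul_invSelf_pow_mem_blowupAlgebra a N hrI⟩ : blowupAlgebra I a) * s =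
          algebraMap R (blowupAlgebra I a) r := by
      apply Subtype.ext
      change algebraMap R (Localization.Away a) r * IsLocalization.Away.invSelf a ^ N *
          ((s : blowupAlgebra I a) : Localization.Away a) = algebraMap R (Localization.Away a) r
      rw [hs, hRA, map_pow, mul_assoc, invSelf_pow_mul_algebraMap_pow a le_rfl, Nat.sub_self, pow_zero,
        mul_one]
    apply mul_right_cancel₀ hs0
    rw [← map_mul, hzs, mul_comm x, ← hy, ← hr]
    exact (IsScalarTower.algebraMap_apply R (blowupAlgebra I a) K r).symm
  exact IsIntegrallyClosed.of_isIntegrallyClosedIn (blowupAlgebra I a) K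

end Algebra

section Scheme

variable {R : Type u} [CommRing R] [IsDomain R] [IsIntegrallyClosed R] (I : Ideal R)

/-- **Lipman 1969, Lemma (5.2)** (affine normal case): if `R` is an integrally closed domain and every power `Iⁿ` of the
ideal `I` is integrally closed («all the positive powers of `𝒥` are complete»), then every local ring of the blowing up
`Bl_I(Spec R) = Proj R[It]` is an integrally closed domain («the scheme obtained by blowing up `𝒥` is normal»): the
blowing up is covered by the charts `D₊(at) ≅ Spec R[I/a]`, `a ∈ I ∖ 0`, whose rings are integrally closed domains
(`isIntegrallyClosed_blowupAlgebra`), and a localization of an integrally closed domain is integrally closed.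
[cite: Lipman1969, Lemma (5.2) (p. 206)] -/
theorem affineBlowup.isIntegrallyClosed_stalk_of_forall_pow
    (hI : ∀ (n : ℕ) (r : R), (∃ (k : ℕ) (c : ℕ → R), (∀ j ∈ Finset.Icc 1 k, c j ∈ (I ^ n) ^ j) ∧
      r ^ k + ∑ j ∈ Finset.Icc 1 k, c j * r ^ (k - j) = 0) → r ∈ I ^ n)
    (y : affineBlowup I) : IsIntegrallyClosed ((affineBlowup I).presheaf.stalk y) := by
  -- a chart `D₊(at) ∋ y`, `a ∈ I`; necessarily `a ≠ 0`
  have hy : y ∈ (⨆ b : I, Proj.basicOpen (reesGrading I) (reesT (I := I) b.1 b.2)) := by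
    rw [affineBlowup.iSup_basicOpen_reesT_eq_top]; trivial
  obtain ⟨⟨a, ha⟩, hya⟩ := Opens.mem_iSup.mp hy
  have ha0 : a ≠ 0 := by
    rintro rfl
    have h0 : reesT (I := I) 0 ha = 0 := Subtype.ext (by rw [coe_reesT, map_zero]; rfl)
    rw [h0] at hya
    exact (Proj.mem_basicOpen (reesGrading I) 0 y).mp hya (Ideal.zero_mem _)
  -- the chart is affine with ring `R[I/a]`, an integrally closed domain
  set U := Proj.basicOpen (reesGrading I) (reesT a ha) with hU
  have hUaff : IsAffineOpen U := Proj.isAffineOpen_basicOpen (reesGrading I) (reesT a ha) (reesT_mem a ha) Nat.one_pos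
  have hM : Submonoid.powers a ≤ nonZeroDivisors R := powers_le_nonZeroDivisors_of_noZeroDivisors ha0
  haveI : IsDomain (Localization.Away a) := IsLocalization.isDomain_localization hM
  haveI : IsIntegrallyClosed (blowupAlgebra I a) := isIntegrallyClosed_blowupAlgebra ha ha0 hI
  let e : blowupAlgebra I a ≃+* Γ(affineBlowup I, U) :=
    (reesChartEquiv a ha).symm.trans
      (Proj.basicOpenIsoAway (reesGrading I) (reesT a ha) (reesT_mem a ha) Nat.one_pos).commRingCatIsoToRingEquiv
  haveI : IsDomain Γ(affineBlowup I, U) := MulEquiv.isDomain (blowupAlgebra I a) e.symm.toMulEquiv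
  haveI : IsIntegrallyClosed Γ(affineBlowup I, U) := IsIntegrallyClosed.of_equiv e
  -- the local ring at `y` is a localization of `Γ(U)` at a prime
  letI := (affineBlowup I).presheaf.algebra_section_stalk (⟨y, hya⟩ : U)
  haveI := hUaff.isLocalization_stalk ⟨y, hya⟩
  exact isIntegrallyClosed_of_isLocalization
    ((affineBlowup I).presheaf.stalk ((⟨y, hya⟩ : U) : affineBlowup I))
    (hUaff.primeIdealOf ⟨y, hya⟩).asIdeal.primeCompl (Ideal.primeCompl_le_nonZeroDivisors _)

end Scheme

end Summit.ResolutionOfSingularities.ResolutionOfSingularities.Theorems.NoZeno.QuadraticTransform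

end
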